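import Summits.ResolutionOfSingularities.ResolutionOfSingularities.Theorems.ShadowGameWin.Negative.Trap

/-!
# `ShadowGameWin` (crux stmt-ResolutionOfSingularities-16159), negative side — part 6a:
# the CURVE FAMILY — the trap `a_ψ = u (v − φ(u))^p` and its moves (every prime, every field)

The landed refutations of `ShadowGame.ShadowGameWin` (`Theorems/ShadowGameShadowGameWinRefutation.lean`,
`Negative/Trap.lean`, `Negative/EveryDim.lean`) are single witnesses.  This file isolates the
MECHANISM in closed form.  For a field `κ` of characteristic `p` and a digit function `ψ : ℕ → κ` put
`a_ψ := u·v^p − Σ_{a ≡ 1 (mod p), a > p} ψ(a)^p · u^a = u · (v − φ(u))^p`, `φ(u) := Σ_{k ≥ 1} ψ(pk+1) u^k`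
(`tail`, `Scurve`).  This part: whatever non-empty centre the resolver A announces, B's answer
"chart `u` if allowed; translate `v` by the next digit `ψ(p+1)`" sends `a_ψ` to `a_ψ` (singleton
centres) or to `a_{shift ψ}`, `shift ψ (a) = ψ (a + p)` (point blow-up: `step_pair_Scurve`,
`step_Scurve`) — B walks along the arc `v = φ(u)` through the infinitely near points — and `a_ψ` with a
live digit is not terminal (`not_terminal_Scurve`).  Part 6b (`CurveFamily.lean`) runs the play: B
beats EVERY strategy from `a_ψ` whenever `ψ` has infinitely many live digits (`φ` not a polynomial).
Refuter seat refuter-cdisprove-stmt-ResolutionOfSingularities-16159-g2-0, 2026-08-17.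
-/

noncomputable section

set_option linter.dupNamespace false

namespace Summit.ResolutionOfSingularities.ResolutionOfSingularities.Theorems.ShadowGameWin.Negative

/-- B's chart (`u` whenever allowed) is legal. [folklore] -/
theorem chart_mem : ∀ F : Finset (Fin 2), F.Nonempty → chart F ∈ F := by decide

/-- The three non-empty centres in two variables. [folklore] -/
theorem centre_cases : ∀ F : Finset (Fin 2), F.Nonempty → F = {0} ∨ F = {1} ∨ F = {0, 1} := by
  decide

section CurveFamily

variable {κ : Type} [Field κ] (p : ℕ)

/-- The pure-`u` tail of the curve trap: coefficient `−ψ(a)^p` at the exponent `(a, 0)` for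
`a ≡ 1 (mod p)`, `a > p` (i.e. `a = pk + 1`, `k ≥ 1`). [folklore] -/
def tail (ψ : ℕ → κ) : (Fin 2 → ℕ) → κ :=
  fun B => if B 1 = 0 ∧ B 0 % p = 1 ∧ p < B 0 then -(ψ (B 0) ^ p) else 0

/-- The curve trap `a_ψ = u v^p + tail = u (v − φ(u))^p`. [folklore] -/
def Scurve (ψ : ℕ → κ) : (Fin 2 → ℕ) → κ := mono (1, p) 1 + tail p ψ

/-- The digit shift performed by one point blow-up (`φ ↦ (φ − φ₁u)/u`). [folklore] -/
def shiftp (ψ : ℕ → κ) : ℕ → κ := fun a => ψ (a + p)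

/-! ### Pure-`u` series are fixed by the chart-`u` blow-up and by the translation of `v` -/

/-- The tail vanishes off the `u`-axis. [folklore] -/
theorem tail_pure (ψ : ℕ → κ) (B : Fin 2 → ℕ) (hB : B 1 ≠ 0) : tail p ψ B = 0 := by
  unfold tail; rw [if_neg (fun h => hB h.1)]

/-- A monomial `u^a` vanishes off the `u`-axis. [folklore] -/
theorem mono_u_pure (a : ℕ) (v : κ) (B : Fin 2 → ℕ) (hB : B 1 ≠ 0) : mono (a, 0) v B = 0 := by
  unfold mono; rw [if_neg (fun h => hB h.2)]

/-- Two monomials with opposite coefficients cancel. [folklore] -/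
theorem mono_add_neg (e : ℕ × ℕ) (v : κ) : mono e v + mono e (-v) = 0 := by
  funext B
  simp only [Pi.add_apply, Pi.zero_apply]
  unfold mono
  split_ifs <;> simp

/-- The point blow-up in the chart `u` fixes every pure-`u` series. [folklore] -/
theorem bl_pair_of_pure (c : (Fin 2 → ℕ) → κ) (hc : ∀ B : Fin 2 → ℕ, B 1 ≠ 0 → c B = 0) :
    bl ({0, 1} : Finset (Fin 2)) 0 c = c := by
  funext B
  unfold bl
  rw [erase_pair, Finset.sum_singleton]
  by_cases hB : B 1 = 0
  · have hupd : Function.update B 0 (B 0 - B 1) = B := by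
      rw [hB, Nat.sub_zero, Function.update_eq_self]
    rw [if_pos (by rw [hB]; exact Nat.zero_le _), hupd]
  · by_cases hle : B 1 ≤ B 0
    · rw [if_pos hle, hc B hB, hc]
      simp only [Function.update_apply, one_ne_zero, if_false]
      exact hB
    · rw [if_neg hle, hc B hB]

/-- The translation `v ↦ v + τ_v` (chart `u` of the point blow-up) fixes every pure-`u` series.
[folklore] -/
theorem tr_pair_of_pure (τ : Fin 2 → κ) (s : ℕ) (c : (Fin 2 → ℕ) → κ)
    (hc : ∀ B : Fin 2 → ℕ, B 1 ≠ 0 → c B = 0) :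
    tr ({0, 1} : Finset (Fin 2)) 0 τ s c = c := by
  funext B
  unfold tr
  rw [erase_pair]
  by_cases hB : B 1 = 0
  · rw [Finset.sum_eq_single (0 : Fin 2 → ℕ)]
    · have hcond : ∀ j : Fin 2, j ∉ ({1} : Finset (Fin 2)) → (0 : Fin 2 → ℕ) j = 0 :=
        fun j _ => rfl
      rw [if_pos hcond, Finset.prod_singleton]
      simp
    · intro D _ hne
      by_cases h0 : ∀ j : Fin 2, j ∉ ({1} : Finset (Fin 2)) → D j = 0
      · rw [if_pos h0, hc, zero_mul]
        have hD0 : D 0 = 0 := h0 0 (by decide)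
        intro hD1
        apply hne
        funext j
        rcases Fin.eq_zero_or_eq_succ j with rfl | ⟨k, rfl⟩
        · exact hD0
        · have hk : k = 0 := Fin.eq_zero k
          subst hk
          simp only [Pi.add_apply, hB, zero_add] at hD1
          exact hD1
      · rw [if_neg h0]
    · intro h; exfalso; apply h
      simp [Fintype.mem_piFinset]
  · rw [hc B hB]
    refine Finset.sum_eq_zero fun D _ => ?_
    by_cases h0 : ∀ j : Fin 2, j ∉ ({1} : Finset (Fin 2)) → D j = 0
    · rw [if_pos h0, hc _ (by simp only [Pi.add_apply]; omega), zero_mul]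
    · rw [if_neg h0]

/-! ### The moves on the curve trap -/

/-- Support of `a_ψ`. [folklore] -/
theorem Scurve_support [hp : Fact p.Prime] (ψ : ℕ → κ) (B : Fin 2 → ℕ) (h : Scurve p ψ B ≠ 0) :
    (B 0 = 1 ∧ B 1 = p) ∨ (B 1 = 0 ∧ B 0 % p = 1 ∧ p < B 0 ∧ ψ (B 0) ≠ 0) := by
  unfold Scurve at h
  rw [Pi.add_apply] at h
  unfold mono tail at h
  by_cases h1 : B 0 = 1 ∧ B 1 = p
  · exact Or.inl h1
  · right
    rw [if_neg (fun h' => h1 ⟨h'.1, h'.2⟩), zero_add] at h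
    by_cases h2 : B 1 = 0 ∧ B 0 % p = 1 ∧ p < B 0
    · refine ⟨h2.1, h2.2.1, h2.2.2, fun hψ => h ?_⟩
      rw [if_pos h2, hψ, zero_pow hp.out.ne_zero, neg_zero]
    · exfalso; apply h; rw [if_neg h2]

/-- `a_ψ` at `(1, p)`. [folklore] -/
theorem Scurve_one_p [hp : Fact p.Prime] (ψ : ℕ → κ) : Scurve p ψ ![1, p] = 1 := by
  unfold Scurve
  rw [Pi.add_apply, tail_pure p ψ _ (by simpa using hp.out.ne_zero)]
  unfold mono
  simp

/-- `a_ψ` on the `u`-axis at a live exponent. [folklore] -/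
theorem Scurve_axis [hp : Fact p.Prime] (ψ : ℕ → κ) (a : ℕ) (ha : a % p = 1) (hpa : p < a) :
    Scurve p ψ ![a, 0] = -(ψ a ^ p) := by
  unfold Scurve
  rw [Pi.add_apply]
  unfold mono tail
  have h0 : ¬ ((0 : ℕ) = p) := fun h => hp.out.ne_zero h.symm
  simp [h0, ha, hpa]

/-- `a_ψ` is clean (its `u`-exponents are `≡ 1 (mod p)`). [folklore] -/
theorem clean_Scurve [hp : Fact p.Prime] (ψ : ℕ → κ) : clean p (Scurve p ψ) = Scurve p ψ := by
  funext B
  unfold clean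
  by_cases h : ∀ j, p ∣ B j
  · rw [if_pos h]
    by_contra hne
    have h0 := h 0
    rcases Scurve_support p ψ B (Ne.symm hne) with ⟨hB, -⟩ | ⟨-, hB, -, -⟩
    · exact hp.out.one_lt.ne' (Nat.dvd_one.mp (hB ▸ h0))
    · rw [Nat.mod_eq_zero_of_dvd h0] at hB
      exact zero_ne_one hB
  · rw [if_neg h]

/-- `{u, v}`-order of `a_ψ` is `p + 1` (the division is by `u^p`). [folklore] -/
theorem mF_pair_Scurve [hp : Fact p.Prime] (ψ : ℕ → κ) :
    mF ({0, 1} : Finset (Fin 2)) (Scurve p ψ) = p + 1 := by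
  refine mF_eq _ _ (p + 1) ![1, p] (by rw [Scurve_one_p]; exact one_ne_zero)
    (by rw [sum_pair]; simp [add_comm]) fun A hA => ?_
  rw [sum_pair]
  rcases Scurve_support p ψ A hA with ⟨h0, h1⟩ | ⟨h1, -, h0, -⟩ <;> omega

/-- `u`-order of `a_ψ` is `< p`. [folklore] -/
theorem mF0_Scurve_lt [hp : Fact p.Prime] (ψ : ℕ → κ) :
    mF ({0} : Finset (Fin 2)) (Scurve p ψ) < p :=
  mF_lt _ _ ![1, p] (by rw [Scurve_one_p]; exact one_ne_zero) p (by simpa using hp.out.one_lt)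

/-- `v`-order of `a_ψ` is `0 < p` as soon as one digit is live. [folklore] -/
theorem mF1_Scurve_lt [hp : Fact p.Prime] (ψ : ℕ → κ) (a : ℕ) (ha : a % p = 1) (hpa : p < a)
    (hψ : ψ a ≠ 0) : mF ({1} : Finset (Fin 2)) (Scurve p ψ) < p :=
  mF_lt _ _ ![a, 0]
    (by rw [Scurve_axis p ψ a ha hpa]; exact neg_ne_zero.mpr (pow_ne_zero _ hψ)) p
    (by simpa using hp.out.pos)

/-- A singleton centre `{u_i}` is the identity on a clean series of `u_i`-order `< p` (any
coefficient field). [folklore] -/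
theorem step_singleton_of_lt (i : Fin 2) (τ : Fin 2 → κ) (c : (Fin 2 → ℕ) → κ)
    (hc : clean p c = c) (hm : mF ({i} : Finset (Fin 2)) c < p) : step p {i} i τ c = c := by
  unfold step
  rw [hc, Nat.div_eq_of_lt hm, mul_zero, bl_self _ _ (Finset.erase_singleton i), dv_zero',
    tr_self _ _ (Finset.erase_singleton i), hc]

/-- Binomial coefficients `C(p, b)` vanish in characteristic `p` for `0 < b < p`. [folklore] -/
theorem choose_mid_eq_zero [hp : Fact p.Prime] [CharP κ p] (b : ℕ) (h0 : b ≠ 0) (hb : b < p) :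
    ((Nat.choose p b : ℕ) : κ) = 0 := by
  rw [CharP.cast_eq_zero_iff κ p]
  exact hp.out.dvd_choose_self h0 hb

/-- An exponent `≡ 1 (mod p)` other than `1` exceeds `p`. [folklore] -/
theorem lt_of_mod_eq_one (b : ℕ) (hm : b % p = 1) (hb : b ≠ 1) : p < b := by
  have hdm := Nat.div_add_mod b p
  have hq : b / p ≠ 0 := by
    intro hq
    rw [hq, mul_zero, zero_add, hm] at hdm
    exact hb hdm.symm
  have hle := Nat.le_mul_of_pos_right p (Nat.pos_of_ne_zero hq)
  omega

/-- The head `u v^p` is fixed by blow-up-then-division (`u v^p ↦ u^(p+1) v^p ↦ u v^p`).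
[folklore] -/
theorem dv_bl_head : dv 0 p (bl ({0, 1} : Finset (Fin 2)) 0 (mono (1, p) (1 : κ))) =
    mono (1, p) 1 := by
  rw [bl_pair_mono, dv0_mono]
  show (if p ≤ 1 + p then mono (1 + p - p, p) (1 : κ) else 0) = mono (1, p) 1
  rw [if_pos (by omega), Nat.add_sub_cancel]

/-- Division by `u^p` shifts the tail and exposes the next digit as the monomial
`−ψ(p+1)^p · u`. [folklore] -/
theorem dv_tail [hp : Fact p.Prime] (ψ : ℕ → κ) :
    dv 0 p (tail p ψ) = mono (1, 0) (-(ψ (1 + p) ^ p)) + tail p (shiftp p ψ) := by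
  have h1p : 1 < p := hp.out.one_lt
  funext B
  rw [Pi.add_apply]
  unfold dv tail mono shiftp
  simp only [Function.update_apply, if_true, one_ne_zero, if_false]
  rw [Nat.add_mod_right]
  by_cases hB1 : B 1 = 0
  · by_cases hm : B 0 % p = 1
    · by_cases hb : B 0 = 1
      · rw [if_pos ⟨hB1, hm, by omega⟩, if_pos ⟨hb, hB1⟩, if_neg (fun h => by omega), hb, add_zero]
      · have hlt := lt_of_mod_eq_one p (B 0) hm hb
        rw [if_pos ⟨hB1, hm, by omega⟩, if_neg (fun h => hb h.1), if_pos ⟨hB1, hm, hlt⟩, zero_add]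
    · have hb : B 0 ≠ 1 := fun hb => hm (by rw [hb]; exact Nat.mod_eq_of_lt h1p)
      rw [if_neg (fun h => hm h.2.1), if_neg (fun h => hb h.1), if_neg (fun h => hm h.2.1),
        add_zero]
  · rw [if_neg (fun h => hB1 h.1), if_neg (fun h => hB1 h.2), if_neg (fun h => hB1 h.1), add_zero]

/-- Translating the head: `u (v + τ)^p = u v^p + τ^p u` in characteristic `p`. [folklore] -/
theorem tr_head [hp : Fact p.Prime] [CharP κ p] (τ : Fin 2 → κ) :
    tr ({0, 1} : Finset (Fin 2)) 0 τ p (mono (1, p) (1 : κ)) =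
      mono (1, p) 1 + mono (1, 0) (τ 1 ^ p) := by
  rw [tr_pair_mono τ p (1, p) 1 (by show p ≤ 1 + p; omega)]
  funext B
  rw [Pi.add_apply]
  unfold mono
  show (if B 0 = 1 ∧ B 1 ≤ p then (1 : κ) * (((Nat.choose p (B 1) : ℕ) : κ) * τ 1 ^ (p - B 1))
    else 0) = (if B 0 = 1 ∧ B 1 = p then (1 : κ) else 0) + (if B 0 = 1 ∧ B 1 = 0 then τ 1 ^ p else 0)
  have hp0 : p ≠ 0 := hp.out.ne_zero
  by_cases h0 : B 0 = 1
  · rcases Nat.lt_trichotomy (B 1) p with hlt | heq | hgt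
    · by_cases hz : B 1 = 0
      · rw [if_pos ⟨h0, hlt.le⟩, if_neg (fun h => hlt.ne h.2), if_pos ⟨h0, hz⟩, hz,
          Nat.choose_zero_right]
        simp
      · rw [if_pos ⟨h0, hlt.le⟩, if_neg (fun h => hlt.ne h.2), if_neg (fun h => hz h.2),
          choose_mid_eq_zero p (B 1) hz hlt]
        simp
    · rw [if_pos ⟨h0, heq.le⟩, if_pos ⟨h0, heq⟩, if_neg (fun h => hp0 (heq.symm.trans h.2)), heq,
        Nat.choose_self]
      simp
    · rw [if_neg (fun h => absurd h.2 (not_le.mpr hgt)), if_neg (fun h => hgt.ne' h.2),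
        if_neg (fun h => by omega)]
      simp
  · rw [if_neg (fun h => h0 h.1), if_neg (fun h => h0 h.1), if_neg (fun h => h0 h.1)]
    simp

/-- THE ARC-FOLLOWING MOVE: the point blow-up, chart `u`, division by `u^p`, translation of `v`
by the next digit `ψ(p+1)` and cleaning send `a_ψ` to `a_{shift ψ}`. [folklore] -/
theorem step_pair_Scurve [hp : Fact p.Prime] [CharP κ p] (ψ : ℕ → κ) (τ : Fin 2 → κ)
    (hτ : τ 1 = ψ (1 + p)) :
    step p ({0, 1} : Finset (Fin 2)) 0 τ (Scurve p ψ) = Scurve p (shiftp p ψ) := by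
  have h1p : 1 < p := hp.out.one_lt
  have hdiv : p * ((p + 1) / p) = p := by
    rw [Nat.div_eq_of_lt_le (k := 1) (by omega) (by omega), mul_one]
  unfold step
  rw [clean_Scurve, mF_pair_Scurve, hdiv]
  rw [show Scurve p ψ = mono (1, p) 1 + tail p ψ from rfl, bl_add, dv_add, dv_bl_head,
    bl_pair_of_pure _ (tail_pure p ψ), dv_tail, tr_add, tr_add, tr_head,
    tr_pair_of_pure τ p _ (mono_u_pure _ _), tr_pair_of_pure τ p _ (tail_pure p _), hτ]
  have hX : mono (1, p) (1 : κ) + mono (1, 0) (ψ (1 + p) ^ p) +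
      (mono (1, 0) (-(ψ (1 + p) ^ p)) + tail p (shiftp p ψ)) = Scurve p (shiftp p ψ) := by
    rw [add_assoc, ← add_assoc (mono (1, 0) (ψ (1 + p) ^ p)), mono_add_neg, zero_add]
    rfl
  rw [hX, clean_Scurve]

/-- B's policy on the curve trap: whatever non-empty centre A announces, B's answer (chart `u`
if allowed, translate `v` by the next digit) keeps `a_ψ` (singletons) or walks to `a_{shift ψ}`
(point blow-up). [folklore] -/
theorem step_Scurve [hp : Fact p.Prime] [CharP κ p] (ψ : ℕ → κ) (a : ℕ) (ha : a % p = 1)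
    (hpa : p < a) (hψ : ψ a ≠ 0) (F : Finset (Fin 2)) (hF : F.Nonempty) (τ : Fin 2 → κ)
    (hτ : τ 1 = ψ (1 + p)) :
    step p F (chart F) τ (Scurve p ψ) =
      Scurve p (if F = ({0, 1} : Finset (Fin 2)) then shiftp p ψ else ψ) := by
  rcases centre_cases F hF with rfl | rfl | rfl
  · rw [show chart {0} = 0 from rfl, if_neg (by decide)]
    exact step_singleton_of_lt p 0 τ _ (clean_Scurve p ψ) (mF0_Scurve_lt p ψ)
  · rw [show chart {1} = 1 from rfl, if_neg (by decide)]
    exact step_singleton_of_lt p 1 τ _ (clean_Scurve p ψ) (mF1_Scurve_lt p ψ a ha hpa hψ)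
  · rw [show chart {0, 1} = 0 from rfl, if_pos rfl]
    exact step_pair_Scurve p ψ τ hτ

/-- `a_ψ` with a live digit is not terminal: clean, non-zero, no monomial of degree `≤ 1`, and
the minimal exponents `(1, p)` and `(a, 0)` are incomparable. [folklore] -/
theorem not_terminal_Scurve [hp : Fact p.Prime] (ψ : ℕ → κ) (a : ℕ) (ha : a % p = 1)
    (hpa : p < a) (hψ : ψ a ≠ 0) :
    ¬ ((∀ A, clean p (Scurve p ψ) A = 0) ∨ ∃ A, clean p (Scurve p ψ) A ≠ 0 ∧
        (Finset.sum Finset.univ (fun j => A j) ≤ 1 ∨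
          ∀ B, clean p (Scurve p ψ) B ≠ 0 → ∀ j, A j ≤ B j)) := by
  have h1p : 1 < p := hp.out.one_lt
  have hax : Scurve p ψ ![a, 0] ≠ 0 := by
    rw [Scurve_axis p ψ a ha hpa]; exact neg_ne_zero.mpr (pow_ne_zero _ hψ)
  rw [clean_Scurve]
  rintro (h0 | ⟨A, hA, hT⟩)
  · exact absurd (h0 ![1, p]) (by rw [Scurve_one_p]; exact one_ne_zero)
  · rcases hT with hT | hT
    · rw [Fin.sum_univ_two] at hT
      rcases Scurve_support p ψ A hA with ⟨h0, h1⟩ | ⟨h1, -, h0, -⟩ <;> omega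
    · have hx := hT ![1, p] (by rw [Scurve_one_p]; exact one_ne_zero) 0
      have hy := hT ![a, 0] hax 1
      simp at hx hy
      rcases Scurve_support p ψ A hA with ⟨h0, h1⟩ | ⟨h1, -, h0, -⟩ <;> omega

end CurveFamily

end Summit.ResolutionOfSingularities.ResolutionOfSingularities.Theorems.ShadowGameWin.Negative

end
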